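import Literature.AnabelianGeometry.EtaleTheta.TowerOfSetting
import Literature.AnabelianGeometry.EtaleTheta.ThetaSectionsOfSetting
import HarnessLib

/-!
# [EtTh] Cor. 2.19 (iii), tower form (`ThetaEnvTower.Cor219_iii`, FACT-LIST F-0650): its CONCLUSION HOLDS for
# every INNER automorphism of `Π^tp_X̲̲`, with `c = 1`, over EVERY §1 theta setting — the `Π^tp_X̲̲`-conjugation
# stability of the mod-`M` theta collections (proof-only)

S. Mochizuki, *The étale theta function and its Frobenioid-theoretic manifestations*, Publ. RIMS **45** (2009)
[EtTh], §2, Cor. 2.19 (iii), PRIMS PDF p. 65 ("an arbitrary automorphism of `Π^tp_X` preserves this collection of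
classes … up to … some multiple"); Def. 2.13 p. 47 ("replacing `η̲̈^{Θ,l·ℤ×μ₂}` by an `O^×_K`-multiple …
corresponds to replacing `s^Θ_Ÿ̲̲` by an `O^×_K`-conjugate", "conjugation by an element of `μ_N` corresponds precisely
to modifying a cocycle by a coboundary"); Def. 2.7 p. 41 ("the `Π^tp_X̲̲/Π^tp_Ÿ̲̲ ≅ (l·ℤ) × μ₂`-orbit `η̲̈^{Θ,l·ℤ×μ₂}`");
Cor. 2.16 p. 54 (conjugate cocycles) [cite: MochizukiEtTh2009, Cor 2.19(iii) p.65].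

Cell `abc-iut`, seat abc-iut-w4-d038 (gen 9), K-L6 / C-R33 row «COR219III-AT-MODELTATE», PART 1 — GENERIC over every
§1 setting `D`, every étale-theta datum `E`, every choice `X̲̲ = C`, every level `μ` / cyclotome tower `τ`.  PROOF-ONLY:
no definition, no instance, no notation, no new named fact; abc-iut-L2-t8's `DoubleUnderline` / `ThetaEnvOfSetting` /
`TowerOfSetting` / `ThetaSectionsOfSetting` (`conj_mem_GtpYdduu`), abc-iut-L2-t2's `ThetaSystems` (`ThetaEnvTower.conjCocycle`, `.pullbackCocycle`), abc-iut-L2-t1's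
`ContH1` / `CyclotomeMod` consumed BY NAME, nothing restated.

WHY.  F-0650 `ThetaEnvTower.Cor219_iii` quantifies over ALL bi-continuous automorphisms `γ` of `Π^tp_X̲̲` stabilising
`Π^tp_Ÿ̲̲` (universal closure refuted at a toy tower, abc-iut-f-154); it is the residual binder `h219iii` of the
model-instance rows of record for [IUTchII] Prop. 1.5 (i)/(ii) and the [EtTh] §2 rigidity rows at the Tate datum
(`MonoThetaProjectiveBridgeEtThAtModelTate`, `Sec2RigidRowsAtModelTateInr`, …), with NO closed producer at any genuine
carrier in the tree.  This file supplies the first such producers — for the INNER part of `Aut(Π^tp_X̲̲)`: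

* `exists_rootCocycle_conj` — the `x`-conjugate `g ↦ θ(x)·f(x⁻¹ g x)·θ(x)⁻¹` (`x ∈ Π^tp_X̲̲`) of a cocycle of the orbit
  `η̲̈^{Θ,l·ℤ×μ₂}` is again an `l·Δ_Θ`-valued continuous cocycle on `Π^tp_Ÿ̲̲` whose class is the `x·σ`-conjugate of
  `η̈^Θ|` — a member of the orbit;
* `thetaCocycles_conj_mem` / `thetaEnvTower_conjCocycle_mem` — hence the collection of mod-`N` theta cocycles of `X̲̲`
  is STABLE under `η ↦ (g ↦ χ(aug x)·η(x⁻¹ g x))` (`(l·Δ_Θ) ↠ μ_N` is `G_K`-equivariant), i.e. under abc-iut-L2-t2's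
  `ThetaEnvTower.conjCocycle M x` at every level of the §1-instantiated tower;
* `thetaEnvTower_coeffAut_eq_of_inner` — for `γ = Inn(x)` every coefficient automorphism `γ̄_M` admitted by the row's
  compatibility hypothesis IS `χ(aug x)` (surjectivity + equivariance of `(l·Δ_Θ) ↠ μ_M`);
* **`cor219_iii_conclusion_of_inner`** — so for every bi-continuous `γ` acting as `Inn(x)` and EVERY admissible
  coefficient family, the conclusion of `ThetaEnvTower.Cor219_iii` holds with the compatible continuous `G_K`-cocycle
  family `c = 1`: pull-back along `(Inn(x), χ(aug x))` is conjugation by `x⁻¹`, under which the collections are stable.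
The residual content of F-0650 at a genuine carrier is therefore the OUTER part of `Aut(Π^tp_X̲̲)`; part 2 of the row
reduces it against Cor. 2.18 (i) at the Tate datum of record.

HONEST FRAMING: unconditional statements about OUR typed objects over an arbitrary §1 setting; nothing of [EtTh]
(refereed) is asserted beyond what is proved here; no side is taken on [IUTchIII] Cor. 3.12; typed ≠ proved; nothing
here asserts abc proved or refuted.
-/

noncomputable section

namespace Literature.AnabelianGeometry.EtaleTheta

open Literature.AnabelianGeometry.SemiGraphs
open scoped IsMulCommutative

namespace ThetaSetting.EtaleThetaData.DoubleUnderline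

variable {p : ℕ} [Fact p.Prime] {D : ThetaSetting p} {E : D.EtaleThetaData} {l : ℕ}
  (C : E.DoubleUnderline l) {N : ℕ+} (μ : D.CyclotomeMod l N)

/-! ## §1. Conjugating a root cocycle by `x ∈ Π^tp_X̲̲` -/

/-- Conjugation by a fixed element of `(Π^tp_X)^Θ` is continuous on `Δ_Θ`. [cite: MochizukiEtTh2009, §1 p.12] -/
theorem continuous_conjNormal_deltaTheta (t : D.GtpTheta) :
    Continuous fun b : D.DeltaTheta => MulAut.conjNormal t b :=
  continuous_induced_rng.2 (by
    simp only [Function.comp_def, MulAut.conjNormal_apply]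
    fun_prop)

/-- **The `x`-conjugate of a root cocycle is a root cocycle** (`x ∈ Π^tp_X̲̲`): the function
`g ↦ θ(x) · f(x⁻¹ g x) · θ(x)⁻¹` on `Π^tp_Ÿ̲̲` (abc-iut-L2-t8's `conjRoot hC x f`) is a continuous `l·Δ_Θ`-valued cocycle whose class is the
`x·σ`-conjugate of `η̈^Θ|_{Π^tp_Ÿ̲̲}` when the class of `f` is the `σ`-conjugate — i.e. it lies in the orbit
`η̲̈^{Θ,l·ℤ×μ₂}` again ("the `Π^tp_X̲̲/Π^tp_Ÿ̲̲ ≅ (l·ℤ) × μ₂`-orbit", p. 41). [cite: MochizukiEtTh2009, Def 2.7 p.41] -/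
theorem exists_rootCocycle_conj (hC : D.Compat) (x : C.Huu)
    (f : contCocycles D.toTheta D.DeltaTheta C.GtpYdduu) (hf : f ∈ C.rootCocycles hC) :
    ∃ (f' : contCocycles D.toTheta D.DeltaTheta C.GtpYdduu) (_ : f' ∈ C.rootCocycles hC),
      ∀ g : C.GtpYdduu, f'.1 g = MulAut.conjNormal (D.toTheta (x : D.PiTemp))
        (f.1 ⟨((x : D.PiTemp))⁻¹ * (g : D.PiTemp) * (x : D.PiTemp), C.conj_mem_GtpYdduu hC x g⟩) := by
  haveI := hC.GtpYdd_normal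
  -- continuity of the ingredients
  have hcontArg : Continuous fun g : C.GtpYdduu =>
      (⟨((x : D.PiTemp))⁻¹ * (g : D.PiTemp) * (x : D.PiTemp), C.conj_mem_GtpYdduu hC x g⟩ : C.GtpYdduu) := by
    apply Continuous.subtype_mk
    exact (continuous_const.mul continuous_subtype_val).mul continuous_const
  -- multiplicativity of `g ↦ x⁻¹ g x`
  have hmul : ∀ g h : C.GtpYdduu,
      (⟨((x : D.PiTemp))⁻¹ * ((g * h : C.GtpYdduu) : D.PiTemp) * (x : D.PiTemp),
        C.conj_mem_GtpYdduu hC x (g * h)⟩ : C.GtpYdduu) =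
        ⟨((x : D.PiTemp))⁻¹ * (g : D.PiTemp) * (x : D.PiTemp), C.conj_mem_GtpYdduu hC x g⟩ *
          ⟨((x : D.PiTemp))⁻¹ * (h : D.PiTemp) * (x : D.PiTemp), C.conj_mem_GtpYdduu hC x h⟩ := by
    intro g h
    apply Subtype.ext
    simp only [Subgroup.coe_mul, MulMemClass.mk_mul_mk]
    group
  -- the cocycle property of the conjugate
  have hF : (fun g : C.GtpYdduu => MulAut.conjNormal (D.toTheta (x : D.PiTemp))
      (f.1 ⟨((x : D.PiTemp))⁻¹ * (g : D.PiTemp) * (x : D.PiTemp), C.conj_mem_GtpYdduu hC x g⟩)) ∈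
      contCocycles D.toTheta D.DeltaTheta C.GtpYdduu := by
    refine ⟨(continuous_conjNormal_deltaTheta (D := D) _).comp (f.2.1.comp hcontArg), fun g h => ?_⟩
    dsimp only
    rw [hmul, f.2.2, map_mul]
    congr 1
    rw [← MulAut.mul_apply, ← MulAut.mul_apply, ← map_mul, ← map_mul]
    congr 2
    simp only [map_mul, map_inv]
    group
  -- the class of `f`: `f = res(conj σ F₀) · ∂d`
  obtain ⟨σ, hσ, hclass⟩ := hf.2
  obtain ⟨F₀, hF₀⟩ : ∃ F₀ : contCocycles D.toTheta D.DeltaTheta D.GtpYdd,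
      (QuotientGroup.mk F₀ : D.H1 D.GtpYdd) = E.etaDd := QuotientGroup.mk_surjective _
  have e1 : (QuotientGroup.mk (ContH1.resCocycle D.toTheta D.DeltaTheta
      (inf_le_left : C.GtpYdduu ≤ D.GtpYdd) (ContH1.conjCocycle D.toTheta D.DeltaTheta σ F₀)) :
        D.H1 C.GtpYdduu) = QuotientGroup.mk f := by
    rw [← hF₀] at hclass
    exact hclass.symm
  rw [QuotientGroup.eq, Subgroup.mem_subgroupOf, mem_contCoboundaries_iff] at e1
  obtain ⟨d, hd⟩ := e1
  -- pointwise form of `hd`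
  have hfk : ∀ k : C.GtpYdduu, f.1 k =
      (ContH1.resCocycle D.toTheta D.DeltaTheta (inf_le_left : C.GtpYdduu ≤ D.GtpYdd)
        (ContH1.conjCocycle D.toTheta D.DeltaTheta σ F₀)).1 k *
        (MulAut.conjNormal (D.toTheta (k : D.PiTemp)) d * d⁻¹) := by
    intro k
    have hk := congrFun hd k
    have hk' : ((ContH1.resCocycle D.toTheta D.DeltaTheta (inf_le_left : C.GtpYdduu ≤ D.GtpYdd)
        (ContH1.conjCocycle D.toTheta D.DeltaTheta σ F₀)).1 k)⁻¹ * f.1 k =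
        MulAut.conjNormal (D.toTheta (k : D.PiTemp)) d * d⁻¹ := hk
    rw [inv_mul_eq_iff_eq_mul] at hk'
    exact hk'
  refine ⟨⟨_, hF⟩, ⟨fun g => ?_, (x : D.PiTemp) * σ, mul_mem x.2 hσ, ?_⟩, fun g => rfl⟩
  · -- values in `l·Δ_Θ`
    change ((MulAut.conjNormal (D.toTheta (x : D.PiTemp))
      (f.1 ⟨((x : D.PiTemp))⁻¹ * (g : D.PiTemp) * (x : D.PiTemp), C.conj_mem_GtpYdduu hC x g⟩) :
        D.DeltaTheta) : D.GtpTheta) ∈ D.lDeltaTheta l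
    rw [MulAut.conjNormal_apply]
    exact (D.lDeltaTheta_normal l).conj_mem _ (hf.1 _) _
  · -- the class is the `x·σ`-conjugate of `η̈^Θ|`
    rw [← hF₀]
    change (QuotientGroup.mk (⟨_, hF⟩ : contCocycles D.toTheta D.DeltaTheta C.GtpYdduu) : D.H1 C.GtpYdduu) =
      QuotientGroup.mk (ContH1.resCocycle D.toTheta D.DeltaTheta (inf_le_left : C.GtpYdduu ≤ D.GtpYdd)
        (ContH1.conjCocycle D.toTheta D.DeltaTheta ((x : D.PiTemp) * σ) F₀))
    rw [QuotientGroup.eq, Subgroup.mem_subgroupOf, mem_contCoboundaries_iff]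
    refine ⟨(MulAut.conjNormal (D.toTheta (x : D.PiTemp)) d)⁻¹, ?_⟩
    funext g
    -- both sides as elements of the commutative group `Δ_Θ`
    change (MulAut.conjNormal (D.toTheta (x : D.PiTemp))
        (f.1 ⟨((x : D.PiTemp))⁻¹ * (g : D.PiTemp) * (x : D.PiTemp), C.conj_mem_GtpYdduu hC x g⟩))⁻¹ *
      (ContH1.resCocycle D.toTheta D.DeltaTheta (inf_le_left : C.GtpYdduu ≤ D.GtpYdd)
        (ContH1.conjCocycle D.toTheta D.DeltaTheta ((x : D.PiTemp) * σ) F₀)).1 g = _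
    rw [hfk]
    -- identify the two conjugate-cocycle values
    have hcc : MulAut.conjNormal (D.toTheta (x : D.PiTemp))
        ((ContH1.resCocycle D.toTheta D.DeltaTheta (inf_le_left : C.GtpYdduu ≤ D.GtpYdd)
          (ContH1.conjCocycle D.toTheta D.DeltaTheta σ F₀)).1
          ⟨((x : D.PiTemp))⁻¹ * (g : D.PiTemp) * (x : D.PiTemp), C.conj_mem_GtpYdduu hC x g⟩) =
        (ContH1.resCocycle D.toTheta D.DeltaTheta (inf_le_left : C.GtpYdduu ≤ D.GtpYdd)
          (ContH1.conjCocycle D.toTheta D.DeltaTheta ((x : D.PiTemp) * σ) F₀)).1 g := by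
      change MulAut.conjNormal (D.toTheta (x : D.PiTemp)) (MulAut.conjNormal (D.toTheta σ)
          (F₀.1 (MulAut.conjNormal σ⁻¹ ⟨((x : D.PiTemp))⁻¹ * (g : D.PiTemp) * (x : D.PiTemp),
            (Subgroup.mem_inf.1 (C.conj_mem_GtpYdduu hC x g)).1⟩))) =
        MulAut.conjNormal (D.toTheta ((x : D.PiTemp) * σ))
          (F₀.1 (MulAut.conjNormal ((x : D.PiTemp) * σ)⁻¹ ⟨(g : D.PiTemp), (Subgroup.mem_inf.1 g.2).1⟩))
      have harg : (MulAut.conjNormal σ⁻¹ (⟨((x : D.PiTemp))⁻¹ * (g : D.PiTemp) * (x : D.PiTemp),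
            (Subgroup.mem_inf.1 (C.conj_mem_GtpYdduu hC x g)).1⟩ : D.GtpYdd) : D.GtpYdd) =
          MulAut.conjNormal ((x : D.PiTemp) * σ)⁻¹ ⟨(g : D.PiTemp), (Subgroup.mem_inf.1 g.2).1⟩ := by
        apply Subtype.ext
        simp only [MulAut.conjNormal_apply, mul_inv_rev, inv_inv]
        group
      rw [← MulAut.mul_apply, ← map_mul, ← map_mul, harg]
    -- the coboundary bookkeeping in the commutative group `Δ_Θ`
    have hdd : MulAut.conjNormal (D.toTheta (x : D.PiTemp))
        (MulAut.conjNormal (D.toTheta ((⟨((x : D.PiTemp))⁻¹ * (g : D.PiTemp) * (x : D.PiTemp),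
          C.conj_mem_GtpYdduu hC x g⟩ : C.GtpYdduu) : D.PiTemp)) d) =
        MulAut.conjNormal (D.toTheta (g : D.PiTemp)) (MulAut.conjNormal (D.toTheta (x : D.PiTemp)) d) := by
      rw [← MulAut.mul_apply, ← MulAut.mul_apply, ← map_mul, ← map_mul]
      congr 2
      simp only [map_mul, map_inv]
      group
    rw [map_mul, map_mul, hcc, map_inv, hdd, mul_inv_rev, mul_inv_rev, inv_inv, map_inv]
    rw [inv_mul_cancel_right, mul_comm]

/-- **The collection of mod-`N` theta cocycles of `X̲̲` is stable under `Π^tp_X̲̲`-conjugation**: for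
`x ∈ Π^tp_X̲̲` and a theta cocycle `η`, the function `g ↦ χ(aug x) · η(x⁻¹ g x)` is again a theta cocycle (the
reduction of the `x`-conjugate root cocycle: `(l·Δ_Θ) ↠ μ_N` is `G_K`-equivariant, `CyclotomeMod.red_conj`).
[cite: MochizukiEtTh2009, Def 2.13 p.47] -/
theorem thetaCocycles_conj_mem (hC : D.Compat) (x : C.Huu) {η : D.GtpYdd.subgroupOf C.Huu → MuN p N}
    (hη : η ∈ C.thetaCocycles hC μ)
    (hmem : ∀ g : D.GtpYdd.subgroupOf C.Huu, x⁻¹ * (g : C.Huu) * x ∈ D.GtpYdd.subgroupOf C.Huu) :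
    (fun g : D.GtpYdd.subgroupOf C.Huu =>
      galMuN p N (D.aug.toMonoidHom (x : D.PiTemp)) (η ⟨x⁻¹ * (g : C.Huu) * x, hmem g⟩)) ∈
      C.thetaCocycles hC μ := by
  obtain ⟨f, hf, rfl⟩ := hη
  obtain ⟨f', hf', hff'⟩ := C.exists_rootCocycle_conj hC x f hf
  refine ⟨f', hf', funext fun g => ?_⟩
  -- `χ(aug x) · red(f(x⁻¹ g x)) = red(θx · f(x⁻¹ g x) · θx⁻¹) = red(f'(g))`
  unfold modN
  rw [← μ.red_conj]
  congr 1
  apply Subtype.ext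
  change D.toTheta (x : D.PiTemp) *
      ((f.1 (C.inclYdduu ⟨x⁻¹ * (g : C.Huu) * x, hmem g⟩) : D.DeltaTheta) : D.GtpTheta) *
      (D.toTheta (x : D.PiTemp))⁻¹ = ((f'.1 (C.inclYdduu g) : D.DeltaTheta) : D.GtpTheta)
  rw [hff' (C.inclYdduu g), MulAut.conjNormal_apply]
  rfl


/-! ## §2. Tower currency: `ThetaEnvTower.conjCocycle` on the §1-instantiated tower -/

section Tower

variable {Es : Set ℕ+} (τ : D.CyclotomeTower l Es)

/-- **The mod-`M` theta collections of the §1-instantiated tower `C.thetaEnvTower τ` are `Π^tp_X̲̲`-stable**: for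
every level `M ∈ E` and `x ∈ Π^tp_X̲̲`, abc-iut-L2-t2's `ThetaEnvTower.conjCocycle M x` maps `thetaCocycles M` into
itself. [cite: MochizukiEtTh2009, Cor 2.16 p.54] -/
theorem thetaEnvTower_conjCocycle_mem (hC : D.Compat) (hS : D.Sec2Hyps) (M : Es)
    (x : (C.thetaEnvTower τ hC hS).PiX) {η : (C.thetaEnvTower τ hC hS).PiYdd → (C.thetaEnvTower τ hC hS).mu M}
    (hη : η ∈ (C.thetaEnvTower τ hC hS).thetaCocycles M) :
    (C.thetaEnvTower τ hC hS).conjCocycle M x η ∈ (C.thetaEnvTower τ hC hS).thetaCocycles M :=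
  C.thetaCocycles_conj_mem (τ.mod M) hC x hη fun g => by
    simpa [mul_assoc] using (C.thetaEnvTower τ hC hS).PiYdd_normal.conj_mem _ g.2 x⁻¹

/-- For `γ = Inn(x)` (`x ∈ Π^tp_X̲̲`), a coefficient automorphism `γ̄_M` of `μ_M` satisfying the compatibility
`thetaMod_M (γ g) = γ̄_M (thetaMod_M g)` that `ThetaEnvTower.Cor219_iii` quantifies over IS `χ(aug x)`: it is
pinned by the surjectivity of `(l·Δ_Θ) ↠ μ_M` and the `G_K`-equivariance of that surjection.
[cite: MochizukiEtTh2009, Cor 2.19(iii) p.65] -/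
theorem thetaEnvTower_coeffAut_eq_of_inner (hC : D.Compat) (hS : D.Sec2Hyps) (M : Es)
    (x : (C.thetaEnvTower τ hC hS).PiX)
    (γ : (C.thetaEnvTower τ hC hS).PiX ≃ₜ* (C.thetaEnvTower τ hC hS).PiX) (hγx : ∀ g, γ g = x * g * x⁻¹)
    (γμ : (C.thetaEnvTower τ hC hS).mu M ≃* (C.thetaEnvTower τ hC hS).mu M)
    (hcompat : ∀ (g : (C.thetaEnvTower τ hC hS).lDeltaTheta) (hg : γ g ∈ (C.thetaEnvTower τ hC hS).lDeltaTheta),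
      (C.thetaEnvTower τ hC hS).thetaMod M ⟨γ g, hg⟩ = γμ ((C.thetaEnvTower τ hC hS).thetaMod M g))
    (m : (C.thetaEnvTower τ hC hS).mu M) :
    γμ m = galMuN p M (D.aug.toMonoidHom (x : D.PiTemp)) m := by
  haveI : (C.thetaEnvTower τ hC hS).lDeltaTheta.Normal := (D.lDeltaTheta_normal l).comap _
  obtain ⟨g, rfl⟩ := (C.thetaEnvTower τ hC hS).thetaMod_surjective M m
  have hg : γ g ∈ (C.thetaEnvTower τ hC hS).lDeltaTheta := by
    rw [hγx]
    exact (inferInstance : (C.thetaEnvTower τ hC hS).lDeltaTheta.Normal).conj_mem _ g.2 _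
  rw [← hcompat g hg]
  change (τ.mod M).red (C.toLDelta ⟨γ g, hg⟩) = galMuN p M (D.aug.toMonoidHom (x : D.PiTemp))
    ((τ.mod M).red (C.toLDelta g))
  rw [← (τ.mod M).red_conj]
  congr 1
  apply Subtype.ext
  simp only [coe_toLDelta, hγx, Subgroup.coe_mul, Subgroup.coe_inv, map_mul, map_inv]

/-- **Cor. 2.19 (iii), tower form — the conclusion HOLDS for every INNER automorphism, with `c = 1`.** For the
§1-instantiated tower of any theta setting, any `X̲̲`, any cyclotome tower: if the bi-continuous automorphism `γ` of
`Π^tp_X̲̲` acts as `Inn(x)` (`x ∈ Π^tp_X̲̲`), then for EVERY admissible coefficient family `(γ̄_M)_M` the pulled-back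
mod-`M` collections coincide with the original ones, so the compatible, locally constant, continuous `G_K`-cocycle
family `c := 1` witnesses the conclusion of `ThetaEnvTower.Cor219_iii` for `γ` (pull-back along `Inn(x)` with
`γ̄_M = χ(aug x)` is conjugation by `x⁻¹`, under which the collection is stable, §1).
[cite: MochizukiEtTh2009, Cor 2.19(iii) p.65] -/
theorem cor219_iii_conclusion_of_inner (hC : D.Compat) (hS : D.Sec2Hyps)
    (x : (C.thetaEnvTower τ hC hS).PiX)
    (γ : (C.thetaEnvTower τ hC hS).PiX ≃ₜ* (C.thetaEnvTower τ hC hS).PiX) (hγx : ∀ g, γ g = x * g * x⁻¹)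
    (hγ : (C.thetaEnvTower τ hC hS).PiYdd.map γ.toMulEquiv.toMonoidHom = (C.thetaEnvTower τ hC hS).PiYdd)
    (γμ : ∀ M : Es, (C.thetaEnvTower τ hC hS).mu M ≃* (C.thetaEnvTower τ hC hS).mu M)
    (hcompat : ∀ (M : Es) (g : (C.thetaEnvTower τ hC hS).lDeltaTheta)
      (hg : γ g ∈ (C.thetaEnvTower τ hC hS).lDeltaTheta),
      (C.thetaEnvTower τ hC hS).thetaMod M ⟨γ g, hg⟩ = γμ M ((C.thetaEnvTower τ hC hS).thetaMod M g)) :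
    ∃ c : ∀ M : Es, (C.thetaEnvTower τ hC hS).G → (C.thetaEnvTower τ hC hS).mu M,
      (∀ M, CycEnvelope.IsEnvCocycle (MonoidHom.id (C.thetaEnvTower τ hC hS).G)
        ((C.thetaEnvTower τ hC hS).chi M) (c M)) ∧
      (∀ M, IsLocallyConstant (c M ∘ (C.thetaEnvTower τ hC hS).aug)) ∧
      (∀ (M M' : Es) (h : (M : ℕ+) ∣ M'), (C.thetaEnvTower τ hC hS).red M M' h ∘ c M' = c M) ∧
      ∀ M, (C.thetaEnvTower τ hC hS).pullbackCocycle M γ hγ (γμ M) ''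
          (C.thetaEnvTower τ hC hS).thetaCocycles M =
        (fun η => η * (c M ∘ (C.thetaEnvTower τ hC hS).aug ∘ (C.thetaEnvTower τ hC hS).PiYdd.subtype)) ''
          (C.thetaEnvTower τ hC hS).thetaCocycles M := by
  refine ⟨fun M _ => 1, fun M g h => ?_, fun M => ?_, fun M M' h => ?_, fun M => ?_⟩
  · simp only [map_one, mul_one]
  · exact IsLocallyConstant.const 1
  · funext σ
    simp only [Function.comp_apply, map_one]
  · -- the right-hand side is the collection itself
    have hrhs : (fun η : (C.thetaEnvTower τ hC hS).PiYdd → (C.thetaEnvTower τ hC hS).mu M =>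
        η * ((fun _ : (C.thetaEnvTower τ hC hS).G => (1 : (C.thetaEnvTower τ hC hS).mu M)) ∘ (C.thetaEnvTower τ hC hS).aug ∘ (C.thetaEnvTower τ hC hS).PiYdd.subtype)) = id := by
      funext η
      funext g
      simp only [Pi.mul_apply, Function.comp_apply, mul_one, id_eq]
    rw [hrhs, Set.image_id]
    -- the pulled-back collection is the `x⁻¹`-conjugate collection
    have hsymm : ∀ m, (γμ M).symm m = galMuN p M (D.aug.toMonoidHom ((x⁻¹ : (C.thetaEnvTower τ hC hS).PiX) : D.PiTemp)) m := by
      intro m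
      apply (γμ M).injective
      rw [MulEquiv.apply_symm_apply,
        C.thetaEnvTower_coeffAut_eq_of_inner τ hC hS M x γ hγx (γμ M) (hcompat M),
        ← MulAut.mul_apply, ← map_mul, ← map_mul, Subgroup.coe_inv, mul_inv_cancel, map_one, map_one,
        MulAut.one_apply]
    have hpull : (C.thetaEnvTower τ hC hS).pullbackCocycle M γ hγ (γμ M) = (C.thetaEnvTower τ hC hS).conjCocycle M x⁻¹ := by
      funext η
      funext g
      change (γμ M).symm (η ⟨γ g, _⟩) = (C.thetaEnvTower τ hC hS).chi M ((C.thetaEnvTower τ hC hS).aug x⁻¹) (η ⟨x⁻¹⁻¹ * g * x⁻¹, _⟩)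
      rw [hsymm]
      change galMuN p M (D.aug.toMonoidHom ((x⁻¹ : (C.thetaEnvTower τ hC hS).PiX) : D.PiTemp)) (η ⟨γ g, _⟩) =
        galMuN p M (D.aug.toMonoidHom ((x⁻¹ : (C.thetaEnvTower τ hC hS).PiX) : D.PiTemp)) (η ⟨x⁻¹⁻¹ * g * x⁻¹, _⟩)
      congr 2
      apply Subtype.ext
      change γ (g : (C.thetaEnvTower τ hC hS).PiX) = x⁻¹⁻¹ * (g : (C.thetaEnvTower τ hC hS).PiX) * x⁻¹
      rw [hγx, inv_inv]
    rw [hpull]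
    apply Set.Subset.antisymm
    · rintro _ ⟨η, hη, rfl⟩
      exact C.thetaEnvTower_conjCocycle_mem τ hC hS M x⁻¹ hη
    · intro η hη
      refine ⟨(C.thetaEnvTower τ hC hS).conjCocycle M x η, C.thetaEnvTower_conjCocycle_mem τ hC hS M x hη, ?_⟩
      funext g
      change (C.thetaEnvTower τ hC hS).chi M ((C.thetaEnvTower τ hC hS).aug x⁻¹) ((C.thetaEnvTower τ hC hS).chi M ((C.thetaEnvTower τ hC hS).aug x) (η ⟨x⁻¹ * _ * x, _⟩)) = η g
      rw [← MulAut.mul_apply, ← map_mul, ← map_mul, inv_mul_cancel, map_one, map_one, MulAut.one_apply]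
      congr 1
      apply Subtype.ext
      change x⁻¹ * (x⁻¹⁻¹ * (g : (C.thetaEnvTower τ hC hS).PiX) * x⁻¹) * x = g
      group

end Tower

end ThetaSetting.EtaleThetaData.DoubleUnderline

end Literature.AnabelianGeometry.EtaleTheta

end
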